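import Literature.Barriers.CriticalPhenomena.KozmaNachmiasRegeneration
import HarnessLib

/-!
# Kozma–Nachmias 2011, Lemma 2.3: the random variables `X_j`, `A_j` and the bound on the term `B₂`

Barrier catalogue `Literature/Barriers/CriticalPhenomena/` (D-0021), companion of
`KozmaNachmiasOneArm.lean` and `KozmaNachmiasRegeneration.lean`. All PROVED:

* measurability of `X_j` (`boundaryConnCount`, (1.3)) and `A_j` (`annulusConnCount`, (1.4)) as
  real-valued functions (finite sums of indicators of connection events);
* `X_j` on `{C(0;Q_j) = C}` equals `|C ∩ ∂Q_j|`, and `X_{j'}`, `j' ≤ j`, is determined there by the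
  edges of `Q_j` touching `C` (Kozma–Nachmias 2011, p. 383: "`C(0; Q_j)` allows us to tell whether
  `j = j₀` or not; no information from the rest of the configuration is needed (here it is important
  that `j₀` is the first such `j`)");
* `real_siteToBoundary_inter_exists_low_le` — **the term `B₂`**: for `T ≥ 0`, radii `j₁ ≤ j₂` and
  `N ≥ j₂ + 1 + m₀`,
  `P(0 ↔ ∂Q_N, ∃ j ∈ [j₁, j₂], X_j ≤ T) ≤ 2d · T · P(0 ↔ ∂Q_{m₀}) · P(0 ↔ ∂Q_{j₁})`, the printed
  `P(B₂) ≤ L² γ(λr/2) γ(r)` (with `T = L²`; the factor `2d` is discussed in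
  `KozmaNachmiasRegeneration.lean`), by `regeneration_bound` applied to the events
  `H_j = {X_j ≤ T, X_{j'} > T for j' < j in the range}` ("`j₀` is the first `j` for which `X_j ≤ L²`").

## References

* G. Kozma, A. Nachmias, J. Amer. Math. Soc. 24 (2011) 375–409: (1.3)–(1.4) p. 378; proof of
  Lemma 2.3, the term `B₂`, pp. 382–383.
-/

noncomputable section

namespace Literature.Barriers.CriticalPhenomena

open _root_.MeasureTheory Finset Literature.Probability.LatticeModels Literature.Probability.Percolation
  Literature.Probability.Percolation.DCT16
open scoped Literature.Probability.LatticeModels Literature.Probability.Percolation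

variable {d : ℕ}

/-! ### Measurability of `X_j` and `A_j` -/

section Measurability

open scoped Classical in
/-- A count of events among finitely many measurable ones is a measurable (real-valued) function:
`ω ↦ |{i ∈ s : ω ∈ E_i}| = Σ_{i ∈ s} 1[ω ∈ E_i]`. [folklore] -/
theorem measurable_card_filter_mem {Ω ι : Type*} [MeasurableSpace Ω] (s : Finset ι)
    {E : ι → Set Ω} (hE : ∀ i ∈ s, MeasurableSet (E i)) :
    Measurable fun ω => ((s.filter fun i => ω ∈ E i).card : ℝ) := by
  classical
  have h : (fun ω => ((s.filter fun i => ω ∈ E i).card : ℝ)) =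
      fun ω => ∑ i ∈ s, if ω ∈ E i then (1 : ℝ) else 0 := by
    funext ω
    rw [Finset.card_filter]
    push_cast
    rfl
  rw [h]
  refine Finset.measurable_sum s fun i hi => Measurable.ite (hE i hi) measurable_const measurable_const

/-- `X_j` is measurable (as a real-valued function). [folklore] -/
theorem measurable_boundaryConnCount (d j : ℕ) :
    Measurable fun ω : BondConfig (Site d) => (boundaryConnCount d j ω : ℝ) := by
  unfold boundaryConnCount
  convert measurable_card_filter_mem (sphere d j)
    (E := fun x => openConnIn (↑(box d j) : Set (Site d)) (0 : Site d) x)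
    (fun x _ => measurableSet_openConnIn (box d j) 0 x) using 1

/-- `A_j` is measurable (as a real-valued function). [folklore] -/
theorem measurable_annulusConnCount (d j L : ℕ) :
    Measurable fun ω : BondConfig (Site d) => (annulusConnCount d j L ω : ℝ) := by
  unfold annulusConnCount
  convert measurable_card_filter_mem (box d (j + L) \ box d j)
    (E := fun y => (openConn (0 : Site d) y : Set (BondConfig (Site d))))
    (fun y _ => measurableSet_openConn_holds (0 : Site d) y) using 1

/-- `{X_j ≤ T}` is measurable. [folklore] -/
theorem measurableSet_boundaryConnCount_le (d j : ℕ) (T : ℝ) :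
    MeasurableSet {ω : BondConfig (Site d) | (boundaryConnCount d j ω : ℝ) ≤ T} :=
  measurableSet_le (measurable_boundaryConnCount d j) measurable_const

/-- `{T < X_j}` is measurable. [folklore] -/
theorem measurableSet_lt_boundaryConnCount (d j : ℕ) (T : ℝ) :
    MeasurableSet {ω : BondConfig (Site d) | T < (boundaryConnCount d j ω : ℝ)} :=
  measurableSet_lt measurable_const (measurable_boundaryConnCount d j)

end Measurability

/-! ### `X_j` on the events `{C(0;Q_j) = C}` -/

section OnCluster

/-- On `{C(0;Q_j) = C}`, `X_j = |C ∩ ∂Q_j|`. [cite: KozmaNachmias2011, (1.3)] -/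
theorem boundaryConnCount_eq_of_clusterEvent {j : ℕ} {C : Finset (Site d)} {ω : BondConfig (Site d)}
    (hω : ω ∈ clusterEvent (box d j) C) :
    boundaryConnCount d j ω = #((sphere d j).filter (· ∈ C)) := by
  classical
  unfold boundaryConnCount
  congr 1
  refine Finset.filter_congr fun x _ => ?_
  change x ∈ clusterSet (box d j) ω ↔ x ∈ C
  rw [show clusterSet (box d j) ω = ↑C from hω, Finset.mem_coe]

/-- **`C(0;Q_j)` with its edges determines the connections inside smaller boxes** (Kozma–Nachmias
2011, p. 383): if `ω ∈ {C(0;Q_j) = C}` and `ω'` agrees with `ω` on the pairs of `Q_j` touching `C`,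
then for `j' ≤ j` every `0 ↔ z in Q_{j'}` of `ω` holds in `ω'` (an open path of `ω` inside
`Q_{j'} ⊆ Q_j` from `0` runs inside `C`, so its edges touch `C`).
[cite: KozmaNachmias2011, proof of Lemma 2.3 (term B₂, p. 383)] -/
theorem openConnIn_box_of_clusterEvent_of_inter_eq {j j' : ℕ} (hj : j' ≤ j) {C : Finset (Site d)}
    {ω ω' : BondConfig (Site d)} (hω : ω ∈ clusterEvent (box d j) C)
    (hag : ω ∩ ↑(clusterPairs (box d j) C) = ω' ∩ ↑(clusterPairs (box d j) C)) {z : Site d}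
    (hz : ω ∈ openConnIn (↑(box d j') : Set (Site d)) 0 z) :
    ω' ∈ openConnIn (↑(box d j') : Set (Site d)) 0 z := by
  rw [mem_openConnIn_iff_pathIn] at hz ⊢
  have hsub : (↑(box d j') : Set (Site d)) ⊆ ↑(box d j) := Finset.coe_subset.2 (box_mono d hj)
  have hz' := pathIn_restrict_cluster hz
  refine (pathIn_congrGraph (G' := openGraph ω') ?_ hz').mono Set.inter_subset_left
  intro a b ha hb hab
  have haC : a ∈ C := by
    have : a ∈ clusterSet (box d j) ω := mem_clusterSet_iff.2 (ha.2.mono hsub)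
    rw [show clusterSet (box d j) ω = ↑C from hω] at this
    exact this
  exact (openGraph_adj_congr hag (Finset.mem_coe.2
    (mk_mem_clusterPairs (box_mono d hj ha.1) (box_mono d hj hb.1) (Or.inl haC)))).1 hab

/-- Hence `X_{j'}`, `j' ≤ j`, takes the same value at `ω ∈ {C(0;Q_j) = C}` and at any `ω'` agreeing
with `ω` on the pairs of `Q_j` touching `C`. [cite: KozmaNachmias2011, proof of Lemma 2.3 (term B₂, p. 383)] -/
theorem boundaryConnCount_congr_of_clusterEvent {j j' : ℕ} (hj : j' ≤ j) {C : Finset (Site d)}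
    {ω ω' : BondConfig (Site d)} (hω : ω ∈ clusterEvent (box d j) C)
    (hag : ω ∩ ↑(clusterPairs (box d j) C) = ω' ∩ ↑(clusterPairs (box d j) C)) :
    boundaryConnCount d j' ω = boundaryConnCount d j' ω' := by
  classical
  have hω' : ω' ∈ clusterEvent (box d j) C :=
    ((determinedBy_iff _ _).1 (determinedBy_clusterEvent (C := C) (zero_mem_box d j)) ω ω' hag).1 hω
  unfold boundaryConnCount
  congr 1
  exact Finset.filter_congr fun z _ =>
    ⟨openConnIn_box_of_clusterEvent_of_inter_eq hj hω hag,
      openConnIn_box_of_clusterEvent_of_inter_eq hj hω' hag.symm⟩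

end OnCluster

/-! ### The events `H_j = {j₀ = j}` and the bound on `B₂` -/

section B2

variable (p : unitInterval)

/-- **The term `B₂` of Kozma–Nachmias 2011, Lemma 2.3** (pp. 382–383: "`P(B₂) ≤ L² γ(λr/2) γ(r)`"),
in the form: for `d ≥ 1`, `T ≥ 0`, radii `j₁, j₂` and `N ≥ j₂ + 1 + m₀`,
`P(0 ↔ ∂Q_N and X_j ≤ T for some j ∈ [j₁, j₂]) ≤ 2d · T · P(0 ↔ ∂Q_{m₀}) · P(0 ↔ ∂Q_{j₁})`.
Proof: with `j₀` the first `j ∈ [j₁, j₂]` with `X_j ≤ T`, the events `H_j = {j₀ = j}` are pairwise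
disjoint, measurable, and on `{C(0;Q_j) = C}` determined by the edges of `Q_j` touching `C`
(`boundaryConnCount_congr_of_clusterEvent`) with `|C ∩ ∂Q_j| = X_j ≤ T`; apply `regeneration_bound`.
In the source `T = L²`, `[j₁, j₂] = [r(1+λ/4), r(1+λ/2)]`, `N = r(1+λ)`, `m₀ = λr/2`.
[cite: KozmaNachmias2011, proof of Lemma 2.3 (term B₂, pp. 382–383)] -/
theorem real_siteToBoundary_inter_exists_low_le (hd : 1 ≤ d) {j₁ j₂ N m₀ : ℕ}
    (hN : j₂ + 1 + m₀ ≤ N) {T : ℝ} (hT0 : 0 ≤ T) :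
    (bondPercolation (zdGraph d) p).real (siteToBoundary d N ∩
        {ω | ∃ j ∈ Finset.Icc j₁ j₂, (boundaryConnCount d j ω : ℝ) ≤ T}) ≤
      2 * d * T * (bondPercolation (zdGraph d) p).real (siteToBoundary d m₀) *
        (bondPercolation (zdGraph d) p).real (siteToBoundary d j₁) := by
  classical
  set J : Finset ℕ := Finset.Icc j₁ j₂ with hJ_def
  -- the events `H_j = {j₀ = j}`
  set H : ℕ → Set (BondConfig (Site d)) := fun j =>
    {ω | (boundaryConnCount d j ω : ℝ) ≤ T ∧ ∀ j' ∈ J, j' < j → T < (boundaryConnCount d j' ω : ℝ)}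
    with hH_def
  -- `{∃ j ∈ J, X_j ≤ T} ⊆ ⋃_j H_j` (take the first such `j`)
  have hcover : siteToBoundary d N ∩ {ω | ∃ j ∈ J, (boundaryConnCount d j ω : ℝ) ≤ T} ⊆
      siteToBoundary d N ∩ ⋃ j ∈ J, H j := by
    rintro ω ⟨hωN, hex⟩
    refine ⟨hωN, ?_⟩
    have hP : ∃ j, j ∈ J ∧ (boundaryConnCount d j ω : ℝ) ≤ T := by
      obtain ⟨j, hj, hjT⟩ := hex; exact ⟨j, hj, hjT⟩
    refine Set.mem_iUnion₂.2 ⟨Nat.find hP, (Nat.find_spec hP).1, (Nat.find_spec hP).2, ?_⟩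
    intro j' hj' hlt
    by_contra hle
    exact Nat.find_min hP hlt ⟨hj', not_lt.1 hle⟩
  refine (measureReal_mono hcover).trans ?_
  refine regeneration_bound p hd hT0 (N := N) (m₀ := m₀) (j₁ := j₁) ?_ ?_ ?_ ?_ ?_
  · -- ranges
    intro j hj
    rw [hJ_def, Finset.mem_Icc] at hj
    exact ⟨hj.1, by omega⟩
  · -- measurability
    intro j _
    have hHeq : H j = {ω | (boundaryConnCount d j ω : ℝ) ≤ T} ∩
        ⋂ j' ∈ J.filter (· < j), {ω | T < (boundaryConnCount d j' ω : ℝ)} := by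
      ext ω
      simp only [hH_def, Set.mem_setOf_eq, Set.mem_inter_iff, Set.mem_iInter, Finset.mem_filter,
        and_imp]
    rw [hHeq]
    exact (measurableSet_boundaryConnCount_le d j T).inter
      (Finset.measurableSet_biInter _ fun j' _ => measurableSet_lt_boundaryConnCount d j' T)
  · -- pairwise disjointness
    intro j hj j' hj' hjj'
    rcases lt_or_gt_of_ne hjj' with hlt | hlt
    · exact Set.disjoint_left.2 fun ω h h' => (not_lt.2 h.1) (h'.2 j hj hlt)
    · exact Set.disjoint_left.2 fun ω h h' => (not_lt.2 h'.1) (h.2 j' hj' hlt)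
  · -- determined by the cluster
    intro j _ C _
    rw [determinedBy_iff]
    suffices key : ∀ ω ω' : BondConfig (Site d),
        ω ∩ ↑(clusterPairs (box d j) C) = ω' ∩ ↑(clusterPairs (box d j) C) →
          ω ∈ clusterEvent (box d j) C ∩ H j → ω' ∈ clusterEvent (box d j) C ∩ H j from
      fun ω ω' h => ⟨key ω ω' h, key ω' ω h.symm⟩
    rintro ω ω' hag ⟨hωC, hωT, hωlt⟩
    have hω' : ω' ∈ clusterEvent (box d j) C :=
      ((determinedBy_iff _ _).1 (determinedBy_clusterEvent (C := C) (zero_mem_box d j)) ω ω' hag).1 hωC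
    refine ⟨hω', ?_, ?_⟩
    · rwa [← boundaryConnCount_congr_of_clusterEvent le_rfl hωC hag]
    · intro j' hj' hlt
      rw [← boundaryConnCount_congr_of_clusterEvent hlt.le hωC hag]
      exact hωlt j' hj' hlt
  · -- `|C ∩ ∂Q_j| = X_j ≤ T` on the event
    rintro j _ C _ ⟨ω, hωC, hωT, -⟩
    rw [← boundaryConnCount_eq_of_clusterEvent hωC]
    exact hωT

end B2

end Literature.Barriers.CriticalPhenomena

end
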